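import Mathlib.Analysis.Calculus.Deriv.Shift
import Literature.MathematicalPhysics.QuantumLattice.FermionGammaDerivative
import HarnessLib

/-!
# Stub `stub_Gamma_path_hasDerivAt` of line `pin-the-infimum` (crux `RobustYangMillsHandover`, 8892)

E2, layer α1 of the fermionic-insertion bricks in Lüscher's transfer-matrix representation of the
QCD torus functional: a source `s` perturbs ONE one-step matrix along a general entrywise
differentiable matrix path `N(s)` with `N(s₀)` invertible, and the second quantisation `Γ = Gamma`
(matrix of minors on the Jordan–Wigner Fock space `Finset ι → ℂ`,
`Literature/MathematicalPhysics/QuantumLattice/FermionGammaFunctor`) responds to first order by the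
Fock operators

  `d/ds Γ(N(s)) = Γ(N) · dΓ(N⁻¹N') = dΓ(N'N⁻¹) · Γ(N)`   (at `s = s₀`, `N = N(s₀)`, `N' = N'(s₀)`),

`dΓ(Y) = Σᵢⱼ Yᵢⱼ c†ᵢ cⱼ` (`FermionQuasiFree`). The statements are ENTRYWISE (scalar `HasDerivAt`
for `s ↦ ⟨S| Γ(N(s)) |T⟩`), so no matrix norm is chosen.

## Proof

By the tree's path-independence lemma
`Literature.MathematicalPhysics.QuantumLattice.hasDerivAt_Gamma_apply_congr_path` (the minors are
polynomials in the entries, so the derivative of `Γ ∘ γ` at `s₀` depends only on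
`(γ(s₀), γ'(s₀))`) it suffices to exhibit ONE path with the endpoint data `(N, N')` along which
the derivative is known. For invertible `N` the affine path `N + (s - s₀) N'` can be written in
the two factorised forms `N (1 + (s - s₀) N⁻¹N')` and `(1 + (s - s₀) N'N⁻¹) N`, and along these
the tree theorem `hasDerivAt_Gamma_mul_one_add_smul_apply` (`d/ds|₀ Γ(g(1 + sY)) = Γ(g) dΓ(Y)`,
shifted to `s₀`) and its mirror `d/ds|₀ Γ((1 + sY)g) = dΓ(Y) Γ(g)` (functoriality `Gamma_mul` +
`hasDerivAt_Gamma_one_add_smul_apply`) give the two forms of the derivative.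

References: J. Dereziński, C. Gérard, *Mathematics of Quantization and Quantum Fields*
(CUP 2013/2022), Prop. 3.23 (1); O. Bratteli, D. W. Robinson, *Operator Algebras and Quantum
Statistical Mechanics 2*, §5.2.1; J. Smit, *Introduction to Quantum Fields on a Lattice*, App. C
(transfer operator for fermions).
-/

open Matrix Literature.MathematicalPhysics.QuantumLattice

namespace Summit.QuantumFields.QCD.Cruxes.RobustYangMillsHandover.PinTheInfimum

namespace StubGammaPathHasDerivAt

/-- The entries of the affine matrix path `s ↦ A + (s - s₀) B` (real parameter, complex matrices)
have derivative `B i j` at `s₀`. [folklore] -/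
theorem hasDerivAt_affine_apply {m n : Type*} (A B : Matrix m n ℂ) (s₀ : ℝ) (i : m) (j : n) :
    HasDerivAt (fun s : ℝ => (A + ((s - s₀ : ℝ) : ℂ) • B) i j) (B i j) s₀ := by
  have h :=
    ((((hasDerivAt_id s₀).sub_const s₀).ofReal_comp).mul_const (B i j)).const_add (A i j)
  rw [Complex.ofReal_one, one_mul] at h
  have hfun : (fun s : ℝ => (A + ((s - s₀ : ℝ) : ℂ) • B) i j) =
      fun s : ℝ => A i j + ((id s - s₀ : ℝ) : ℂ) * B i j := by
    funext s
    rfl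
  rwa [hfun]

variable {ι : Type*} [LinearOrder ι] [Fintype ι]

/-- **`d/ds|₀ Γ((1 + sY) g) = dΓ(Y) Γ(g)`** entrywise, for arbitrary one-body matrices `Y, g`: the
mirror of `hasDerivAt_Gamma_mul_one_add_smul_apply` (functoriality `Γ((1 + sY)g) = Γ(1 + sY) Γ(g)`
and `hasDerivAt_Gamma_one_add_smul_apply`). Dereziński–Gérard Prop. 3.23 (1). [folklore] -/
theorem hasDerivAt_Gamma_one_add_smul_mul_apply (Y g : Matrix ι ι ℂ) (S T : Finset ι) :
    HasDerivAt (fun s : ℝ => Gamma ((1 + (s : ℂ) • Y) * g) S T)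
      ((dGamma Y * Gamma g) S T) 0 := by
  have hfun : (fun s : ℝ => Gamma ((1 + (s : ℂ) • Y) * g) S T) =
      fun s : ℝ => ∑ U, Gamma (1 + (s : ℂ) • Y) S U * Gamma g U T := by
    funext s
    rw [Gamma_mul, Matrix.mul_apply]
  rw [hfun, Matrix.mul_apply]
  exact HasDerivAt.fun_sum fun U _ => (hasDerivAt_Gamma_one_add_smul_apply Y S U).mul_const _

omit [Fintype ι] in
/-- **Reduction to an affine model path.** If `γ` has entrywise derivative `γ'` at `s₀` and `γ₂` is
(any presentation of) the affine path `s ↦ γ(s₀) + (s - s₀) γ'`, then every entry of `Γ ∘ γ` has at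
`s₀` the same derivative as the corresponding entry of `Γ ∘ γ₂` (path independence of the
derivative of the minors, `hasDerivAt_Gamma_apply_congr_path`). [folklore] -/
theorem hasDerivAt_Gamma_apply_of_eq_affine {γ γ₂ : ℝ → Matrix ι ι ℂ} {γ' : Matrix ι ι ℂ}
    {s₀ : ℝ} (hγ : ∀ i j, HasDerivAt (fun s => γ s i j) (γ' i j) s₀)
    (hγ₂ : ∀ s, γ₂ s = γ s₀ + ((s - s₀ : ℝ) : ℂ) • γ') {S T : Finset ι} {D : ℂ}
    (hD : HasDerivAt (fun s => Gamma (γ₂ s) S T) D s₀) :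
    HasDerivAt (fun s => Gamma (γ s) S T) D s₀ := by
  have h₂ : ∀ i j, HasDerivAt (fun s => γ₂ s i j) (γ' i j) s₀ := by
    intro i j
    have hfun : (fun s => γ₂ s i j) = fun s => (γ s₀ + ((s - s₀ : ℝ) : ℂ) • γ') i j := by
      funext s
      rw [hγ₂ s]
    rw [hfun]
    exact hasDerivAt_affine_apply (γ s₀) γ' s₀ i j
  have h₀ : γ s₀ = γ₂ s₀ := by
    rw [hγ₂ s₀, sub_self, Complex.ofReal_zero, zero_smul, add_zero]
  exact hasDerivAt_Gamma_apply_congr_path hγ h₂ h₀ hD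

/-- **`d/ds Γ(γ(s)) = Γ(γ(s₀)) dΓ(γ(s₀)⁻¹ γ'(s₀))` at `s₀`** (entrywise), for an entrywise
differentiable matrix path with `γ(s₀)` invertible: compare with the factorised affine path
`γ(s₀)(1 + (s - s₀) γ(s₀)⁻¹γ')` and use `hasDerivAt_Gamma_mul_one_add_smul_apply`.
Dereziński–Gérard Prop. 3.23 (1); Bratteli–Robinson II §5.2.1. [folklore] -/
theorem hasDerivAt_Gamma_apply_left {γ : ℝ → Matrix ι ι ℂ} {γ' : Matrix ι ι ℂ} {s₀ : ℝ}
    (hγ : ∀ i j, HasDerivAt (fun s => γ s i j) (γ' i j) s₀) (hdet : IsUnit (γ s₀).det)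
    (S T : Finset ι) :
    HasDerivAt (fun s => Gamma (γ s) S T)
      ((Gamma (γ s₀) * dGamma ((γ s₀)⁻¹ * γ')) S T) s₀ := by
  refine hasDerivAt_Gamma_apply_of_eq_affine hγ
    (γ₂ := fun s => γ s₀ * (1 + ((s - s₀ : ℝ) : ℂ) • ((γ s₀)⁻¹ * γ'))) (fun s => ?_) ?_
  · rw [Matrix.mul_add, Matrix.mul_one, Matrix.mul_smul,
      Matrix.mul_nonsing_inv_cancel_left _ _ hdet]
  · have h : HasDerivAt (fun s : ℝ => Gamma (γ s₀ * (1 + (s : ℂ) • ((γ s₀)⁻¹ * γ'))) S T)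
        ((Gamma (γ s₀) * dGamma ((γ s₀)⁻¹ * γ')) S T) (s₀ - s₀) := by
      rw [sub_self]
      exact hasDerivAt_Gamma_mul_one_add_smul_apply (γ s₀) ((γ s₀)⁻¹ * γ') S T
    exact h.comp_sub_const s₀ s₀

/-- **`d/ds Γ(γ(s)) = dΓ(γ'(s₀) γ(s₀)⁻¹) Γ(γ(s₀))` at `s₀`** (entrywise), for an entrywise
differentiable matrix path with `γ(s₀)` invertible: compare with the factorised affine path
`(1 + (s - s₀) γ'γ(s₀)⁻¹) γ(s₀)` and use `hasDerivAt_Gamma_one_add_smul_mul_apply`.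
Dereziński–Gérard Prop. 3.23 (1); Bratteli–Robinson II §5.2.1. [folklore] -/
theorem hasDerivAt_Gamma_apply_right {γ : ℝ → Matrix ι ι ℂ} {γ' : Matrix ι ι ℂ} {s₀ : ℝ}
    (hγ : ∀ i j, HasDerivAt (fun s => γ s i j) (γ' i j) s₀) (hdet : IsUnit (γ s₀).det)
    (S T : Finset ι) :
    HasDerivAt (fun s => Gamma (γ s) S T)
      ((dGamma (γ' * (γ s₀)⁻¹) * Gamma (γ s₀)) S T) s₀ := by
  refine hasDerivAt_Gamma_apply_of_eq_affine hγ
    (γ₂ := fun s => (1 + ((s - s₀ : ℝ) : ℂ) • (γ' * (γ s₀)⁻¹)) * γ s₀) (fun s => ?_) ?_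
  · rw [Matrix.add_mul, Matrix.one_mul, Matrix.smul_mul,
      Matrix.nonsing_inv_mul_cancel_right _ _ hdet]
  · have h : HasDerivAt (fun s : ℝ => Gamma ((1 + (s : ℂ) • (γ' * (γ s₀)⁻¹)) * γ s₀) S T)
        ((dGamma (γ' * (γ s₀)⁻¹) * Gamma (γ s₀)) S T) (s₀ - s₀) := by
      rw [sub_self]
      exact hasDerivAt_Gamma_one_add_smul_mul_apply (γ' * (γ s₀)⁻¹) (γ s₀) S T
    exact h.comp_sub_const s₀ s₀

end StubGammaPathHasDerivAt

/-- **E2 α1: the derivative of the Fock functor along a general differentiable one-body path with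
invertible value** (entrywise): if `s ↦ γ(s) : Matrix ι ι ℂ` has entrywise derivative `γ'` at
`s₀` and `det γ(s₀)` is a unit, then for all `S, T : Finset ι`
`d/ds|_{s₀} ⟨S|Γ(γ(s))|T⟩ = ⟨S| Γ(γ(s₀)) dΓ(γ(s₀)⁻¹ γ') |T⟩ = ⟨S| dΓ(γ' γ(s₀)⁻¹) Γ(γ(s₀)) |T⟩`
— the Fock operator a source-dependent one-step matrix `N(s)` in a transfer-matrix product
`⋯ Γ(N(s)) ⋯` produces to first order (Dereziński–Gérard, *Mathematics of Quantization and
Quantum Fields*, Prop. 3.23 (1); Bratteli–Robinson II §5.2.1; path independence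
`Literature.MathematicalPhysics.QuantumLattice.hasDerivAt_Gamma_apply_congr_path`). The statement
is the registered stub signature verbatim. [folklore] -/
theorem stub_Gamma_path_hasDerivAt :
    ∀ (ι : Type) [LinearOrder ι] [Fintype ι] (γ : ℝ → Matrix ι ι ℂ) (γ' : Matrix ι ι ℂ) (s₀ : ℝ),
      (∀ i j, HasDerivAt (fun s => γ s i j) (γ' i j) s₀) → IsUnit (γ s₀).det →
      ∀ S T : Finset ι,
        HasDerivAt (fun s => Gamma (γ s) S T) ((Gamma (γ s₀) * dGamma ((γ s₀)⁻¹ * γ')) S T) s₀ ∧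
        HasDerivAt (fun s => Gamma (γ s) S T) ((dGamma (γ' * (γ s₀)⁻¹) * Gamma (γ s₀)) S T) s₀ := by
  intro ι _ _ γ γ' s₀ hγ hdet S T
  exact ⟨StubGammaPathHasDerivAt.hasDerivAt_Gamma_apply_left hγ hdet S T,
    StubGammaPathHasDerivAt.hasDerivAt_Gamma_apply_right hγ hdet S T⟩

end Summit.QuantumFields.QCD.Cruxes.RobustYangMillsHandover.PinTheInfimum
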